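import Summits.NavierStokesRegularity.NavierStokesRegularity.Theorems.TerminalTraceTypeITraceScarL3LogMeanApexTimeLayer
import Summits.NavierStokesRegularity.NavierStokesRegularity.Theorems.TerminalTraceTypeITraceScarL3SqrtTwoApexEnergyFloor
import Summits.NavierStokesRegularity.NavierStokesRegularity.Theorems.TerminalTraceTypeITraceScarL3SqrtTwoApexAnnulusBounds
import Summits.NavierStokesRegularity.NavierStokesRegularity.Theorems.TerminalTraceTypeITraceScarL3SqrtTwoApexRepresentativeData
import Summits.NavierStokesRegularity.NavierStokesRegularity.Theorems.TerminalTraceTypeITraceScarL3SqrtTwoApexAssemblyTools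
import Summits.NavierStokesRegularity.NavierStokesRegularity.Theorems.TerminalTraceTypeITraceScarL3LoudDustPacking
import HarnessLib

/-!
# The log-mean ENGINE of ROUND-28 (T28-B modulo the shell pressure budget, representative form): an extinct
# Type-I apex that is backward singular at the origin and quiet on a shell slab, whose representative obeys a
# time-dependent rate `‖V(s)‖ ≤ β(s)`, `β² ≤ 2p/(−s)`, with log-window means of `p` at most `q`, has `1 ≤ q`
# (item `TerminalTrace.TypeITraceScarL3`, stmt-NavierStokesRegularity-18385, Stub LOUD line; helpers)

Seat nsreg-C26-p1 g2 (cell ns-regularity-ideate), `--supports stmt-NavierStokesRegularity-18385` (helper);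
planner-of-record nsreg-p2 g29 (ROUND-28 «CEILING AND MEAN» §3, T28-A/B; DIRECTOR-NS #130 (2)).

* **`one_le_logMean_of_quietShell_of_reprBudget`** — the twin of `two_le_rateSq_of_quietShell_of_reprBudget`
  (`…SqrtTwoApexEngine`): same package clauses (suitable in every `Q(a)`, weak gradient, `𝐈 ≤ M`, `D ≤ D₀`,
  weakly null top), backward-singular origin, QUIET shell slab `]−δ,0[ × {R < |y| < AR}`, continuous jointly
  smooth representative `V` with `U = V` a.e., the constant pointwise rate `‖V(s)‖ ≤ C/√(−s)` (ANY `C` — it only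
  runs the cubic floor and the window bounds), classical windows and the representative-form shell pressure
  budget; NEW: on a final interval `]T,0[` a time-dependent rate `‖V(s, y)‖ ≤ β(s)` with `β(s)² ≤ 2p(s)/(−s)`,
  `p ≥ 0`, a primitive `P' = p/(−s)` and the log-mean hypothesis (LM_q): `P(s) − P(s') ≤ q·log((−s')/(−s)) + K₀`
  (`T < s' ≤ s < 0`, `K₀ ≥ 0`).  Conclusion: `1 ≤ q`.  Proof = the proof of the √2 engine verbatim (cut-off,
  annulus data, `E' ≤ 2m₁`, cubic floor, extinction) with the last line `one_le_logMean_of_shellData`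
  (`…LogMeanApexTimeLayer`, p605615) instead of `two_le_rateSq_of_shellData`.

With `β ≡ C/√(−s)`, `p ≡ C²/2`, `q = C²/2`, `K₀ = 0` this is the √2 engine again.  WHAT THIS IS NOT: not the
transfer of (LM_q) through the zoom (T28-C proper), not Stub LOUD, not NS regularity.
[folklore; Ghidaglia 1986; Agmon–Nirenberg 1967; Temam IDDS 1997 §III.6; Seregin2014 Prop. 6.20]
-/

noncomputable section

set_option linter.dupNamespace false

namespace Summit.NavierStokesRegularity.NavierStokesRegularity.Theorems.TypeITraceScarL3

open MeasureTheory Set Function Filter Topology Metric InnerProductSpace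
open Literature.Analysis Literature.Analysis.FluidPDE
open scoped NNReal ENNReal RealInnerProductSpace ContDiff Laplacian

/-- **The log-mean engine** (module docstring): `1 ≤ q` for a backward-singular extinct Type-I apex that is
quiet on a shell slab, given a classical representative with a uniform gauge-free shell budget of its window
pressures and a time-dependent rate `β`, `β² ≤ 2p/(−s)`, whose log-window means are at most `q` (slack `K₀`).
[folklore; Ghidaglia 1986; Agmon–Nirenberg 1967; Temam IDDS §III.6; ROUND-28 §3 T28-A/B] -/
theorem one_le_logMean_of_quietShell_of_reprBudget {M D₀ : ℝ≥0} {C : ℝ}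
    {U V : ℝ → EuclideanSpace ℝ (Fin 3) → EuclideanSpace ℝ (Fin 3)}
    {P : ℝ → EuclideanSpace ℝ (Fin 3) → ℝ}
    {G : ℝ → EuclideanSpace ℝ (Fin 3) → EuclideanSpace ℝ (Fin 3) →L[ℝ] EuclideanSpace ℝ (Fin 3)}
    (hsw : ∀ a : ℝ, 0 < a →
      IsSuitableWeakSolutionInBall a (0 : ℝ × EuclideanSpace ℝ (Fin 3)) U P)
    (hG : ∀ a : ℝ, 0 < a →
      HasWeakSpatialGradientOn
        (parabolicCylinderOpens a (0 : ℝ × EuclideanSpace ℝ (Fin 3))) U G)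
    (hI : ∀ a : ℝ, 0 < a →
      typeIBound (parabolicCylinder a (0 : ℝ × EuclideanSpace ℝ (Fin 3))) U P G ≤ M)
    (hD : ∀ z₀ : ℝ × EuclideanSpace ℝ (Fin 3), z₀.1 ≤ 0 →
      ∀ r : ℝ, 0 < r → cknD r z₀ P ≤ D₀)
    (htop : ∀ φ : EuclideanSpace ℝ (Fin 3) → EuclideanSpace ℝ (Fin 3),
      ContDiff ℝ (⊤ : ℕ∞) φ →
      HasCompactSupport φ → ∀ ε : ℝ, 0 < ε →
      ∃ s₀ : ℝ, s₀ < 0 ∧ ∀ᵐ s ∂(volume.restrict (Ioo s₀ 0)), |∫ y, ⟪U s y, φ y⟫| ≤ ε)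
    (hsing : IsBackwardSingularPoint U (0 : ℝ × EuclideanSpace ℝ (Fin 3)))
    {A R δ K : ℝ} (hA : 1 < A) (hR : 0 < R) (hδ : 0 < δ)
    (hq : ∀ᵐ z ∂(volume.restrict
      (Ioo (-δ) 0 ×ˢ {y : EuclideanSpace ℝ (Fin 3) | R < ‖y‖ ∧ ‖y‖ < A * R})), ‖U z.1 z.2‖ ≤ K)
    (hUV : ∀ᵐ w ∂(volume.restrict (Iio (0 : ℝ) ×ˢ (univ : Set (EuclideanSpace ℝ (Fin 3))))),
      uncurry U w = uncurry V w)
    (hVc : ContinuousOn (uncurry V) (Iio (0 : ℝ) ×ˢ (univ : Set (EuclideanSpace ℝ (Fin 3)))))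
    (hsm : IsSmoothSpaceTimeOn (Iio 0) V)
    (hdec : ∀ s : ℝ, s < 0 → ∀ y, ‖V s y‖ ≤ C / Real.sqrt (-s))
    (hwin : ∀ a c : ℝ, a < c → c < 0 →
      ∃ q : ℝ → EuclideanSpace ℝ (Fin 3) → ℝ, IsClassicalNSSolutionOn (Ioo a c) 1 0 V q)
    (hPq : ∃ mP δP : ℝ, 0 < δP ∧ ∀ t ∈ Ioo (-δP) 0,
      ∀ (a c : ℝ) (q : ℝ → EuclideanSpace ℝ (Fin 3) → ℝ), t ∈ Ioo a c →
        IsClassicalNSSolutionOn (Ioo a c) 1 0 V q →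
        ∃ cst : ℝ, ∫ y in {y : EuclideanSpace ℝ (Fin 3) |
          (5 * R + 4 * (A * R)) / 9 ≤ ‖y‖ ∧ ‖y‖ ≤ (4 * R + 5 * (A * R)) / 9}, |q t y - cst| ≤ mP)
    {T : ℝ} (hT : T < 0) {β p Pβ : ℝ → ℝ} {q K₀ : ℝ} (hK₀ : 0 ≤ K₀)
    (hβ : ∀ s ∈ Ioo T 0, ∀ y, ‖V s y‖ ≤ β s)
    (hpβ : ∀ s ∈ Ioo T 0, β s ^ 2 ≤ 2 * p s / (-s)) (hpnn : ∀ s ∈ Ioo T 0, 0 ≤ p s)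
    (hP : ∀ s ∈ Ioo T 0, HasDerivAt Pβ (p s / (-s)) s)
    (hLM : ∀ s' ∈ Ioo T 0, ∀ s ∈ Ioo T 0, s' ≤ s → Pβ s - Pβ s' ≤ q * Real.log ((-s') / (-s)) + K₀) :
    1 ≤ q := by
  -- ### constants and radii
  have hC0 : 0 ≤ C := by
    have h := hdec (-1) (by norm_num) 0
    rw [neg_neg, Real.sqrt_one, div_one] at h
    exact (norm_nonneg _).trans h
  have hAR : R < A * R := by nlinarith
  obtain ⟨ρ₁, hρ₁⟩ : ∃ ρ₁ : ℝ, ρ₁ = (5 * R + 4 * (A * R)) / 9 := ⟨_, rfl⟩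
  obtain ⟨ρ₂, hρ₂⟩ : ∃ ρ₂ : ℝ, ρ₂ = (4 * R + 5 * (A * R)) / 9 := ⟨_, rfl⟩
  rw [← hρ₁, ← hρ₂] at hPq
  have hρ₁pos : 0 < ρ₁ := by rw [hρ₁]; positivity
  have hρ₁₂ : ρ₁ < ρ₂ := by rw [hρ₁, hρ₂]; linarith
  have hR₁ρ₁ : (2 * R + A * R) / 3 < ρ₁ := by rw [hρ₁]; linarith
  have hρ₂R₂ : ρ₂ < (R + 2 * A * R) / 3 := by rw [hρ₂]; linarith
  -- ### the cut-off and the derivative data on the annulus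
  obtain ⟨φ, Mφ, Cφ, hφ, hφc, hφ1, hφ0, hφ01, hMφ, hCφ, hφbd, hdφ⟩ := exists_cutoff_with_bounds hρ₁pos hρ₁₂
  obtain ⟨K', hK', hKbd⟩ := iteratedFDeriv_repr_le_on_annulus hsw hD htop hδ hR hA hq hUV hVc
  obtain ⟨mP, δP, hδP, hPq⟩ := hPq
  -- ### the base time interval
  obtain ⟨s₀, hs₀def⟩ : ∃ s₀ : ℝ, s₀ = max (max (max (-(δ / 2)) (-δP)) (-ρ₁ ^ 2)) T := ⟨_, rfl⟩
  have hs₀ : s₀ < 0 := by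
    rw [hs₀def]; exact max_lt (max_lt (max_lt (by linarith) (by linarith)) (by nlinarith)) hT
  have hs₀δ : -(δ / 2) ≤ s₀ := by
    rw [hs₀def]; exact ((le_max_left _ _).trans (le_max_left _ _)).trans (le_max_left _ _)
  have hs₀P : -δP ≤ s₀ := by
    rw [hs₀def]; exact ((le_max_right _ _).trans (le_max_left _ _)).trans (le_max_left _ _)
  have hs₀ρ : -ρ₁ ^ 2 ≤ s₀ := by rw [hs₀def]; exact (le_max_right _ _).trans (le_max_left _ _)
  have hs₀T : T ≤ s₀ := by rw [hs₀def]; exact le_max_right _ _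
  have hIT : Ioo s₀ 0 ⊆ Ioo T 0 := Ioo_subset_Ioo hs₀T le_rfl
  have hV' : IsSmoothSpaceTimeOn (Ioo s₀ 0) V := hsm.mono fun t ht => ht.2
  -- the nonnegative budget
  have hmP : ∀ t ∈ Ioo s₀ 0, ∃ (a c : ℝ) (q : ℝ → EuclideanSpace ℝ (Fin 3) → ℝ), t ∈ Ioo a c ∧
      IsClassicalNSSolutionOn (Ioo a c) 1 0 V q ∧
      ∃ cst : ℝ, ∫ y in {y : EuclideanSpace ℝ (Fin 3) | ρ₁ ≤ ‖y‖ ∧ ‖y‖ ≤ ρ₂}, |q t y - cst| ≤ max mP 0 := by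
    intro t ht
    obtain ⟨q, hcl⟩ := hwin (t - 1) (t / 2) (by linarith [ht.2]) (by linarith [ht.2])
    have htac : t ∈ Ioo (t - 1) (t / 2) := ⟨by linarith, by linarith [ht.2]⟩
    obtain ⟨cst, hcst⟩ := hPq t ⟨by linarith [ht.1], ht.2⟩ _ _ q htac hcl
    exact ⟨t - 1, t / 2, q, htac, hcl, cst, hcst.trans (le_max_left _ _)⟩
  have hdiv : ∀ t ∈ Ioo s₀ 0, VectorCalculus.IsDivFree (V t) := by
    intro t ht
    obtain ⟨a, c, q, htac, hcl, -⟩ := hmP t ht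
    exact hcl.divFree t htac
  -- annulus bounds
  have hbd : ∀ t ∈ Ioo s₀ 0, ∀ y ∈ {y : EuclideanSpace ℝ (Fin 3) | ρ₁ ≤ ‖y‖ ∧ ‖y‖ ≤ ρ₂},
      ‖V t y‖ ≤ (3 + 24 * Mφ) * K' ∧ ‖(Δ (V t)) y‖ ≤ (3 + 24 * Mφ) * K' ∧
        ‖(Δ (fun y => φ y • V t y)) y‖ ≤ (3 + 24 * Mφ) * K' ∧
        ‖fderiv ℝ (Δ (fun y => φ y • V t y)) y‖ ≤ (3 + 24 * Mφ) * K' := by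
    intro t ht y hy
    have ht' : t ∈ Ioo (-(δ / 2)) 0 := ⟨lt_of_le_of_lt hs₀δ ht.1, ht.2⟩
    have hVb : ∀ j ≤ 3, ‖iteratedFDeriv ℝ j (V t) y‖ ≤ K' := fun j hj =>
      hKbd t ht' y (lt_of_lt_of_le hR₁ρ₁ hy.1) (lt_of_le_of_lt hy.2 hρ₂R₂) j (by omega)
    exact annulusBounds_of_iteratedFDeriv_le hφ (hsm.contDiff_slice ht.2) hMφ hK' (fun i hi => hφbd y i hi) hVb
  have hB : 0 ≤ (3 + 24 * Mφ) * K' := by positivity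
  have hrate : ∀ t ∈ Ioo s₀ 0, ∀ y ∈ tsupport φ, ‖V t y‖ ≤ β t := fun t ht y _ => hβ t (hIT ht) y
  have hβ0 : ∀ t ∈ Ioo s₀ 0, 0 ≤ β t := fun t ht => (norm_nonneg _).trans (hβ t (hIT ht) 0)
  -- ### the energy derivative and `E' ≤ 2 m₁`
  have hEder : ∀ t ∈ Ioo s₀ 0, HasDerivAt (fun s => ∫ y, ‖φ y • V s y‖ ^ 2)
      (-2 * (∫ y, frobeniusNormSq (fderiv ℝ (fun y => φ y • V t y) y)) +
        2 * ((∫ y, frobeniusNormSq (fderiv ℝ (fun y => φ y • V t y) y)) +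
          ∫ y, ⟪φ y • V t y, φ y • deriv (fun s => V s y) t⟫)) t :=
    fun t ht => hasDerivAt_cutoffEnergy_shell hV' hφ hφc ht
  have hvol : 0 ≤ (volume {y : EuclideanSpace ℝ (Fin 3) | ρ₁ ≤ ‖y‖ ∧ ‖y‖ ≤ ρ₂}).toReal :=
    ENNReal.toReal_nonneg
  have hm₁ : 0 ≤ (2 * ((3 + 24 * Mφ) * K') ^ 2 + Cφ * ((3 + 24 * Mφ) * K') ^ 3) *
      (volume {y : EuclideanSpace ℝ (Fin 3) | ρ₁ ≤ ‖y‖ ∧ ‖y‖ ≤ ρ₂}).toReal +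
        2 * Cφ * ((3 + 24 * Mφ) * K') * max mP 0 := by positivity
  have hE'le : ∀ t ∈ Ioo s₀ 0,
      -2 * (∫ y, frobeniusNormSq (fderiv ℝ (fun y => φ y • V t y) y)) +
        2 * ((∫ y, frobeniusNormSq (fderiv ℝ (fun y => φ y • V t y) y)) +
          ∫ y, ⟪φ y • V t y, φ y • deriv (fun s => V s y) t⟫) ≤
      2 * ((2 * ((3 + 24 * Mφ) * K') ^ 2 + Cφ * ((3 + 24 * Mφ) * K') ^ 3) *
        (volume {y : EuclideanSpace ℝ (Fin 3) | ρ₁ ≤ ‖y‖ ∧ ‖y‖ ≤ ρ₂}).toReal +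
          2 * Cφ * ((3 + 24 * Mφ) * K') * max mP 0) := by
    intro t ht
    have hS := abs_energySource_le ht hV' (hdiv t ht) (hmP t ht) hφ hφ1 hφ0 hφ01 hCφ hdφ hB
      fun y hy => ⟨(hbd t ht y hy).1, (hbd t ht y hy).2.1, (hbd t ht y hy).2.2.1⟩
    have hDnn : 0 ≤ ∫ y, frobeniusNormSq (fderiv ℝ (fun y => φ y • V t y) y) :=
      integral_nonneg fun y => frobeniusNormSq_nonneg _
    have hS' := (abs_le.mp hS).2
    linarith
  -- ### the cubic floor
  obtain ⟨κ, hκ, Hκ⟩ := exists_cknC_ge_of_topSingular D₀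
  have hcknC : ∀ r : ℝ, 0 < r → ENNReal.ofReal κ ≤ cknC r (0 : ℝ × EuclideanSpace ℝ (Fin 3)) U :=
    fun r hr => Hκ U P G M hsw hG hI hD 0 hsing r hr
  have hEint : ∀ τ : ℝ, τ < 0 → Integrable (fun y => ‖φ y • V τ y‖ ^ 2)
      (volume : Measure (EuclideanSpace ℝ (Fin 3))) := fun τ hτ =>
    ((hφ.continuous.smul (hsm.contDiff_slice hτ).continuous).norm.pow 2).integrable_of_hasCompactSupport
      (HasCompactSupport.intro hφc fun y hy => by simp [image_eq_zero_of_notMem_tsupport hy])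
  have hlate : ∀ s ∈ Ioo s₀ 0, ∃ σ ∈ Ico s 0,
      κ / (2 * C + 1) * Real.sqrt (-s) ≤ ∫ y, ‖φ y • V σ y‖ ^ 2 := fun s hs =>
    exists_late_energy_ge_of_cknC_ge hκ hC0 hρ₁pos hcknC hUV hVc hdec hφ1 hEint
      ⟨lt_of_le_of_lt hs₀ρ hs.1, hs.2⟩
  obtain ⟨c, hc, s₂, hs₂, hs₀₂, hfloor⟩ := floor_of_deriv_le_of_late_energy hs₀ (by positivity)
    (div_pos hκ (by linarith)) hEder hE'le hlate
  -- ### extinction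
  have hEc : ContinuousOn (fun s => ∫ y, ‖φ y • V s y‖ ^ 2) (Ioo s₀ 0) :=
    fun t ht => (hEder t ht).continuousAt.continuousWithinAt
  have hext := tendsto_cutoffEnergy_zero hsw hI hD htop (ae_slice_eq_of_ae_eq_slab hUV) hφ01 hφ0 hs₀
    (fun s hs => hEint s hs.2) hEc
  -- ### conclude on `]s₂, 0[`
  have hsub : Ioo s₂ 0 ⊆ Ioo s₀ 0 := Ioo_subset_Ioo hs₀₂ le_rfl
  have hsubT : Ioo s₂ 0 ⊆ Ioo T 0 := hsub.trans hIT
  exact one_le_logMean_of_shellData hs₂ (hsm.mono fun t ht => ht.2) (fun t ht => hdiv t (hsub ht))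
    (fun t ht => hmP t (hsub ht)) hφ hφ1 hφ0 hφ01 hCφ hdφ hB (le_max_right _ _)
    (fun t ht => hbd t (hsub ht)) hK₀ (fun t ht => hβ0 t (hsub ht)) (fun t ht => hrate t (hsub ht))
    (fun t ht => hpβ t (hsubT ht)) (fun t ht => hpnn t (hsubT ht)) (fun t ht => hP t (hsubT ht))
    (fun s' hs' s hs h => hLM s' (hsubT hs') s (hsubT hs) h) hc hfloor hext

/-- **The log-mean engine, LOCAL RATE** (appended for T28-C (B1)): the same as
`one_le_logMean_of_quietShell_of_reprBudget` with the time-dependent rate `‖V(s, y)‖ ≤ β(s)` asked only on the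
ball `{|y| < A R}` containing the shell (the proof reads the rate on the support of the cut-off only, which lies
in `{|y| ≤ (4R+5AR)/9} ⊂ {|y| < AR}`).  [folklore; Ghidaglia 1986; Agmon–Nirenberg 1967; ROUND-28 §3] -/
theorem one_le_logMean_of_quietShell_of_reprBudget_ball {M D₀ : ℝ≥0} {C : ℝ}
    {U V : ℝ → EuclideanSpace ℝ (Fin 3) → EuclideanSpace ℝ (Fin 3)}
    {P : ℝ → EuclideanSpace ℝ (Fin 3) → ℝ}
    {G : ℝ → EuclideanSpace ℝ (Fin 3) → EuclideanSpace ℝ (Fin 3) →L[ℝ] EuclideanSpace ℝ (Fin 3)}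
    (hsw : ∀ a : ℝ, 0 < a →
      IsSuitableWeakSolutionInBall a (0 : ℝ × EuclideanSpace ℝ (Fin 3)) U P)
    (hG : ∀ a : ℝ, 0 < a →
      HasWeakSpatialGradientOn
        (parabolicCylinderOpens a (0 : ℝ × EuclideanSpace ℝ (Fin 3))) U G)
    (hI : ∀ a : ℝ, 0 < a →
      typeIBound (parabolicCylinder a (0 : ℝ × EuclideanSpace ℝ (Fin 3))) U P G ≤ M)
    (hD : ∀ z₀ : ℝ × EuclideanSpace ℝ (Fin 3), z₀.1 ≤ 0 →
      ∀ r : ℝ, 0 < r → cknD r z₀ P ≤ D₀)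
    (htop : ∀ φ : EuclideanSpace ℝ (Fin 3) → EuclideanSpace ℝ (Fin 3),
      ContDiff ℝ (⊤ : ℕ∞) φ →
      HasCompactSupport φ → ∀ ε : ℝ, 0 < ε →
      ∃ s₀ : ℝ, s₀ < 0 ∧ ∀ᵐ s ∂(volume.restrict (Ioo s₀ 0)), |∫ y, ⟪U s y, φ y⟫| ≤ ε)
    (hsing : IsBackwardSingularPoint U (0 : ℝ × EuclideanSpace ℝ (Fin 3)))
    {A R δ K : ℝ} (hA : 1 < A) (hR : 0 < R) (hδ : 0 < δ)
    (hq : ∀ᵐ z ∂(volume.restrict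
      (Ioo (-δ) 0 ×ˢ {y : EuclideanSpace ℝ (Fin 3) | R < ‖y‖ ∧ ‖y‖ < A * R})), ‖U z.1 z.2‖ ≤ K)
    (hUV : ∀ᵐ w ∂(volume.restrict (Iio (0 : ℝ) ×ˢ (univ : Set (EuclideanSpace ℝ (Fin 3))))),
      uncurry U w = uncurry V w)
    (hVc : ContinuousOn (uncurry V) (Iio (0 : ℝ) ×ˢ (univ : Set (EuclideanSpace ℝ (Fin 3)))))
    (hsm : IsSmoothSpaceTimeOn (Iio 0) V)
    (hdec : ∀ s : ℝ, s < 0 → ∀ y, ‖V s y‖ ≤ C / Real.sqrt (-s))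
    (hwin : ∀ a c : ℝ, a < c → c < 0 →
      ∃ q : ℝ → EuclideanSpace ℝ (Fin 3) → ℝ, IsClassicalNSSolutionOn (Ioo a c) 1 0 V q)
    (hPq : ∃ mP δP : ℝ, 0 < δP ∧ ∀ t ∈ Ioo (-δP) 0,
      ∀ (a c : ℝ) (q : ℝ → EuclideanSpace ℝ (Fin 3) → ℝ), t ∈ Ioo a c →
        IsClassicalNSSolutionOn (Ioo a c) 1 0 V q →
        ∃ cst : ℝ, ∫ y in {y : EuclideanSpace ℝ (Fin 3) |
          (5 * R + 4 * (A * R)) / 9 ≤ ‖y‖ ∧ ‖y‖ ≤ (4 * R + 5 * (A * R)) / 9}, |q t y - cst| ≤ mP)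
    {T : ℝ} (hT : T < 0) {β p Pβ : ℝ → ℝ} {q K₀ : ℝ} (hK₀ : 0 ≤ K₀)
    (hβ : ∀ s ∈ Ioo T 0, ∀ y : EuclideanSpace ℝ (Fin 3), ‖y‖ < A * R → ‖V s y‖ ≤ β s)
    (hpβ : ∀ s ∈ Ioo T 0, β s ^ 2 ≤ 2 * p s / (-s)) (hpnn : ∀ s ∈ Ioo T 0, 0 ≤ p s)
    (hP : ∀ s ∈ Ioo T 0, HasDerivAt Pβ (p s / (-s)) s)
    (hLM : ∀ s' ∈ Ioo T 0, ∀ s ∈ Ioo T 0, s' ≤ s → Pβ s - Pβ s' ≤ q * Real.log ((-s') / (-s)) + K₀) :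
    1 ≤ q := by
  -- ### constants and radii
  have hC0 : 0 ≤ C := by
    have h := hdec (-1) (by norm_num) 0
    rw [neg_neg, Real.sqrt_one, div_one] at h
    exact (norm_nonneg _).trans h
  have hAR : R < A * R := by nlinarith
  obtain ⟨ρ₁, hρ₁⟩ : ∃ ρ₁ : ℝ, ρ₁ = (5 * R + 4 * (A * R)) / 9 := ⟨_, rfl⟩
  obtain ⟨ρ₂, hρ₂⟩ : ∃ ρ₂ : ℝ, ρ₂ = (4 * R + 5 * (A * R)) / 9 := ⟨_, rfl⟩
  rw [← hρ₁, ← hρ₂] at hPq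
  have hρ₁pos : 0 < ρ₁ := by rw [hρ₁]; positivity
  have hρ₁₂ : ρ₁ < ρ₂ := by rw [hρ₁, hρ₂]; linarith
  have hR₁ρ₁ : (2 * R + A * R) / 3 < ρ₁ := by rw [hρ₁]; linarith
  have hρ₂R₂ : ρ₂ < (R + 2 * A * R) / 3 := by rw [hρ₂]; linarith
  -- ### the cut-off and the derivative data on the annulus
  obtain ⟨φ, Mφ, Cφ, hφ, hφc, hφ1, hφ0, hφ01, hMφ, hCφ, hφbd, hdφ⟩ := exists_cutoff_with_bounds hρ₁pos hρ₁₂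
  obtain ⟨K', hK', hKbd⟩ := iteratedFDeriv_repr_le_on_annulus hsw hD htop hδ hR hA hq hUV hVc
  obtain ⟨mP, δP, hδP, hPq⟩ := hPq
  -- ### the base time interval
  obtain ⟨s₀, hs₀def⟩ : ∃ s₀ : ℝ, s₀ = max (max (max (-(δ / 2)) (-δP)) (-ρ₁ ^ 2)) T := ⟨_, rfl⟩
  have hs₀ : s₀ < 0 := by
    rw [hs₀def]; exact max_lt (max_lt (max_lt (by linarith) (by linarith)) (by nlinarith)) hT
  have hs₀δ : -(δ / 2) ≤ s₀ := by
    rw [hs₀def]; exact ((le_max_left _ _).trans (le_max_left _ _)).trans (le_max_left _ _)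
  have hs₀P : -δP ≤ s₀ := by
    rw [hs₀def]; exact ((le_max_right _ _).trans (le_max_left _ _)).trans (le_max_left _ _)
  have hs₀ρ : -ρ₁ ^ 2 ≤ s₀ := by rw [hs₀def]; exact (le_max_right _ _).trans (le_max_left _ _)
  have hs₀T : T ≤ s₀ := by rw [hs₀def]; exact le_max_right _ _
  have hIT : Ioo s₀ 0 ⊆ Ioo T 0 := Ioo_subset_Ioo hs₀T le_rfl
  have hV' : IsSmoothSpaceTimeOn (Ioo s₀ 0) V := hsm.mono fun t ht => ht.2
  -- the nonnegative budget
  have hmP : ∀ t ∈ Ioo s₀ 0, ∃ (a c : ℝ) (q : ℝ → EuclideanSpace ℝ (Fin 3) → ℝ), t ∈ Ioo a c ∧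
      IsClassicalNSSolutionOn (Ioo a c) 1 0 V q ∧
      ∃ cst : ℝ, ∫ y in {y : EuclideanSpace ℝ (Fin 3) | ρ₁ ≤ ‖y‖ ∧ ‖y‖ ≤ ρ₂}, |q t y - cst| ≤ max mP 0 := by
    intro t ht
    obtain ⟨q, hcl⟩ := hwin (t - 1) (t / 2) (by linarith [ht.2]) (by linarith [ht.2])
    have htac : t ∈ Ioo (t - 1) (t / 2) := ⟨by linarith, by linarith [ht.2]⟩
    obtain ⟨cst, hcst⟩ := hPq t ⟨by linarith [ht.1], ht.2⟩ _ _ q htac hcl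
    exact ⟨t - 1, t / 2, q, htac, hcl, cst, hcst.trans (le_max_left _ _)⟩
  have hdiv : ∀ t ∈ Ioo s₀ 0, VectorCalculus.IsDivFree (V t) := by
    intro t ht
    obtain ⟨a, c, q, htac, hcl, -⟩ := hmP t ht
    exact hcl.divFree t htac
  -- annulus bounds
  have hbd : ∀ t ∈ Ioo s₀ 0, ∀ y ∈ {y : EuclideanSpace ℝ (Fin 3) | ρ₁ ≤ ‖y‖ ∧ ‖y‖ ≤ ρ₂},
      ‖V t y‖ ≤ (3 + 24 * Mφ) * K' ∧ ‖(Δ (V t)) y‖ ≤ (3 + 24 * Mφ) * K' ∧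
        ‖(Δ (fun y => φ y • V t y)) y‖ ≤ (3 + 24 * Mφ) * K' ∧
        ‖fderiv ℝ (Δ (fun y => φ y • V t y)) y‖ ≤ (3 + 24 * Mφ) * K' := by
    intro t ht y hy
    have ht' : t ∈ Ioo (-(δ / 2)) 0 := ⟨lt_of_le_of_lt hs₀δ ht.1, ht.2⟩
    have hVb : ∀ j ≤ 3, ‖iteratedFDeriv ℝ j (V t) y‖ ≤ K' := fun j hj =>
      hKbd t ht' y (lt_of_lt_of_le hR₁ρ₁ hy.1) (lt_of_le_of_lt hy.2 hρ₂R₂) j (by omega)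
    exact annulusBounds_of_iteratedFDeriv_le hφ (hsm.contDiff_slice ht.2) hMφ hK' (fun i hi => hφbd y i hi) hVb
  have hB : 0 ≤ (3 + 24 * Mφ) * K' := by positivity
  -- the support of the cut-off lies in the closed ball of radius `ρ₂ < A R`
  have htsupp : ∀ y ∈ tsupport φ, ‖y‖ < A * R := by
    intro y hy
    have hsub : tsupport φ ⊆ {y : EuclideanSpace ℝ (Fin 3) | ‖y‖ ≤ ρ₂} := by
      refine closure_minimal (fun y hy => ?_) (isClosed_le continuous_norm continuous_const)
      by_contra hlt
      simp only [mem_setOf_eq, not_le] at hlt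
      exact hy (hφ0 y hlt.le)
    have h1 : ‖y‖ ≤ ρ₂ := hsub hy
    have h2 : (R + 2 * A * R) / 3 ≤ A * R := by linarith
    linarith
  have hrate : ∀ t ∈ Ioo s₀ 0, ∀ y ∈ tsupport φ, ‖V t y‖ ≤ β t :=
    fun t ht y hy => hβ t (hIT ht) y (htsupp y hy)
  have hβ0 : ∀ t ∈ Ioo s₀ 0, 0 ≤ β t := fun t ht =>
    (norm_nonneg _).trans (hβ t (hIT ht) 0 (by rw [norm_zero]; positivity))
  -- ### the energy derivative and `E' ≤ 2 m₁`
  have hEder : ∀ t ∈ Ioo s₀ 0, HasDerivAt (fun s => ∫ y, ‖φ y • V s y‖ ^ 2)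
      (-2 * (∫ y, frobeniusNormSq (fderiv ℝ (fun y => φ y • V t y) y)) +
        2 * ((∫ y, frobeniusNormSq (fderiv ℝ (fun y => φ y • V t y) y)) +
          ∫ y, ⟪φ y • V t y, φ y • deriv (fun s => V s y) t⟫)) t :=
    fun t ht => hasDerivAt_cutoffEnergy_shell hV' hφ hφc ht
  have hvol : 0 ≤ (volume {y : EuclideanSpace ℝ (Fin 3) | ρ₁ ≤ ‖y‖ ∧ ‖y‖ ≤ ρ₂}).toReal :=
    ENNReal.toReal_nonneg
  have hm₁ : 0 ≤ (2 * ((3 + 24 * Mφ) * K') ^ 2 + Cφ * ((3 + 24 * Mφ) * K') ^ 3) *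
      (volume {y : EuclideanSpace ℝ (Fin 3) | ρ₁ ≤ ‖y‖ ∧ ‖y‖ ≤ ρ₂}).toReal +
        2 * Cφ * ((3 + 24 * Mφ) * K') * max mP 0 := by positivity
  have hE'le : ∀ t ∈ Ioo s₀ 0,
      -2 * (∫ y, frobeniusNormSq (fderiv ℝ (fun y => φ y • V t y) y)) +
        2 * ((∫ y, frobeniusNormSq (fderiv ℝ (fun y => φ y • V t y) y)) +
          ∫ y, ⟪φ y • V t y, φ y • deriv (fun s => V s y) t⟫) ≤
      2 * ((2 * ((3 + 24 * Mφ) * K') ^ 2 + Cφ * ((3 + 24 * Mφ) * K') ^ 3) *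
        (volume {y : EuclideanSpace ℝ (Fin 3) | ρ₁ ≤ ‖y‖ ∧ ‖y‖ ≤ ρ₂}).toReal +
          2 * Cφ * ((3 + 24 * Mφ) * K') * max mP 0) := by
    intro t ht
    have hS := abs_energySource_le ht hV' (hdiv t ht) (hmP t ht) hφ hφ1 hφ0 hφ01 hCφ hdφ hB
      fun y hy => ⟨(hbd t ht y hy).1, (hbd t ht y hy).2.1, (hbd t ht y hy).2.2.1⟩
    have hDnn : 0 ≤ ∫ y, frobeniusNormSq (fderiv ℝ (fun y => φ y • V t y) y) :=
      integral_nonneg fun y => frobeniusNormSq_nonneg _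
    have hS' := (abs_le.mp hS).2
    linarith
  -- ### the cubic floor
  obtain ⟨κ, hκ, Hκ⟩ := exists_cknC_ge_of_topSingular D₀
  have hcknC : ∀ r : ℝ, 0 < r → ENNReal.ofReal κ ≤ cknC r (0 : ℝ × EuclideanSpace ℝ (Fin 3)) U :=
    fun r hr => Hκ U P G M hsw hG hI hD 0 hsing r hr
  have hEint : ∀ τ : ℝ, τ < 0 → Integrable (fun y => ‖φ y • V τ y‖ ^ 2)
      (volume : Measure (EuclideanSpace ℝ (Fin 3))) := fun τ hτ =>
    ((hφ.continuous.smul (hsm.contDiff_slice hτ).continuous).norm.pow 2).integrable_of_hasCompactSupport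
      (HasCompactSupport.intro hφc fun y hy => by simp [image_eq_zero_of_notMem_tsupport hy])
  have hlate : ∀ s ∈ Ioo s₀ 0, ∃ σ ∈ Ico s 0,
      κ / (2 * C + 1) * Real.sqrt (-s) ≤ ∫ y, ‖φ y • V σ y‖ ^ 2 := fun s hs =>
    exists_late_energy_ge_of_cknC_ge hκ hC0 hρ₁pos hcknC hUV hVc hdec hφ1 hEint
      ⟨lt_of_le_of_lt hs₀ρ hs.1, hs.2⟩
  obtain ⟨c, hc, s₂, hs₂, hs₀₂, hfloor⟩ := floor_of_deriv_le_of_late_energy hs₀ (by positivity)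
    (div_pos hκ (by linarith)) hEder hE'le hlate
  -- ### extinction
  have hEc : ContinuousOn (fun s => ∫ y, ‖φ y • V s y‖ ^ 2) (Ioo s₀ 0) :=
    fun t ht => (hEder t ht).continuousAt.continuousWithinAt
  have hext := tendsto_cutoffEnergy_zero hsw hI hD htop (ae_slice_eq_of_ae_eq_slab hUV) hφ01 hφ0 hs₀
    (fun s hs => hEint s hs.2) hEc
  -- ### conclude on `]s₂, 0[`
  have hsub : Ioo s₂ 0 ⊆ Ioo s₀ 0 := Ioo_subset_Ioo hs₀₂ le_rfl
  have hsubT : Ioo s₂ 0 ⊆ Ioo T 0 := hsub.trans hIT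
  exact one_le_logMean_of_shellData hs₂ (hsm.mono fun t ht => ht.2) (fun t ht => hdiv t (hsub ht))
    (fun t ht => hmP t (hsub ht)) hφ hφ1 hφ0 hφ01 hCφ hdφ hB (le_max_right _ _)
    (fun t ht => hbd t (hsub ht)) hK₀ (fun t ht => hβ0 t (hsub ht)) (fun t ht => hrate t (hsub ht))
    (fun t ht => hpβ t (hsubT ht)) (fun t ht => hpnn t (hsubT ht)) (fun t ht => hP t (hsubT ht))
    (fun s' hs' s hs h => hLM s' (hsubT hs') s (hsubT hs) h) hc hfloor hext

end Summit.NavierStokesRegularity.NavierStokesRegularity.Theorems.TypeITraceScarL3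

end
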